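import Summits.QuantumFields.YangMills.Theorems.BalabanLadderIRcofSchurFejerIsotypic
import Summits.QuantumFields.YangMills.Theorems.BalabanLadderIRcofSchurFejerSplitVanishing
import HarnessLib

/-!
# Schur–Fejér splitting — §6 (6e–6f): GENERATION (some Schur monomial of isotypic characters is a twist character for a PRIMITIVE root) and ★ `splitVanishingAt_of_cyclic_ker`

Ideator `ym-ir-idea-22` g4 · crux `IRcof` (stmt-QuantumFields-26930) · row 47 stub S2ᵛ; source `Cruxes/IRcof/Lines/equipartition_seam_SchurFejerCore.lean`
rev 8 (c954a4ca1dd2d859) §6 «arbitrary faithful `ρH`: twist characters, the isotypic Schur monomial, generation», extracted VERBATIM by the custody LEAD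
ym-ir-line-ab-p1 g7 (LEAD LANE PROTOCOL (b); critic ym-ir-crit-3 g4 «LAND-ASK #4 WORD = GO» 22:06:44Z, K1‴–K4‴).  The 400-line cap forces THREE files
(`…SchurFejerTwistChar` = 6a–6b + algebra, `…SchurFejerIsotypic` = isotypic amplitudes ∕ projections ∕ characters + the Schur monomial,
`…SchurFejerCyclicKer` = generation + ★ `splitVanishingAt_of_cyclic_ker`); this file: `sum_isoAmp`, `exists_iso_nondegenerate`, `exists_exponents` (finite cyclic-group generation), `isSplitWindow_windowOf`, `exists_isSplitWindow_of_cyclic` (a split window for ANY finite central cyclic kernel and ANY faithful `ρH`), `splitVanishingAt_cyclic_general`, ★ `splitVanishingAt_of_cyclic_ker` (S2ᵛ's body at every cover datum with finite central CYCLIC kernel; hypotheses = a sub-list of the stub's binders + `IsCyclic π.ker`).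
Same namespace `…EquipartitionSeam.SchurFejer` (no wholesale `open` downstream).  Gate-forced only: one-line docstrings where the lint requires them
(and `private` on a tree-duplicate if the dedup gate names one).  HONEST: the located lemma S2ᵛ of one registered line, proved on the cyclic-kernel sub-class;
walls S3 ∕ S5ᵛ untouched; width 0; YM mass gap (Clay) NOT proved; `IRcof` 0∕1; R4 = `BalabanLadder.UV` only.
-/

set_option autoImplicit false

noncomputable section

open Finset Complex

namespace Summit.QuantumFields.YangMills.Cruxes.IRcof.EquipartitionSeam.SchurFejer

open scoped ComplexOrder Matrix

section Generation

open Literature.MathematicalPhysics.QuantumFieldTheory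

variable {H : Type} [Group H] [TopologicalSpace H]

/-- `ρH(k₀)^m A_j = (ω^j)^m A_j`. -/
theorem rho_pow_mul_isoAmp (ρH : LatticeRep H) {k₀ : H} {N : ℕ} (hN : orderOf k₀ = N) {ω : ℂ}
    (hωN : ω ^ N = 1) (hω0 : ω ≠ 0) (j m : ℕ) :
    ρH.ρ (k₀ ^ m) * isoAmp ρH k₀ ω N j = (ω ^ j) ^ m • isoAmp ρH k₀ ω N j := by
  induction m with
  | zero => rw [pow_zero, map_one, Matrix.one_mul, pow_zero, one_smul]
  | succ m ih =>
      rw [pow_succ', map_mul, Matrix.mul_assoc, ih, Matrix.mul_smul, rho_mul_isoAmp ρH hN hωN hω0,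
        smul_smul, ← pow_succ]

/-- COMPLETENESS `Σ_{j<N} A_j = N · 1` (orthogonality of the characters of `ℤ_N`). -/
theorem sum_isoAmp (ρH : LatticeRep H) (k₀ : H) {N : ℕ} (hNpos : 0 < N) {ω : ℂ}
    (hω : IsPrimitiveRoot ω N) :
    ∑ j ∈ range N, isoAmp ρH k₀ ω N j = (N : ℂ) • (1 : Matrix (Fin ρH.N) (Fin ρH.N) ℂ) := by
  have hω0 : ω ≠ 0 := hω.ne_zero hNpos.ne'
  unfold isoAmp
  rw [Finset.sum_comm]
  have hterm : ∀ m ∈ range N, ∑ j ∈ range N, ((ω ^ j)⁻¹) ^ m • ρH.ρ (k₀ ^ m) =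
      (∑ j ∈ range N, ((ω⁻¹) ^ m) ^ j) • ρH.ρ (k₀ ^ m) := by
    intro m _
    rw [Finset.sum_smul]
    refine Finset.sum_congr rfl fun j _ => ?_
    rw [← inv_pow, ← pow_mul, ← pow_mul, mul_comm]
  rw [Finset.sum_congr rfl hterm, Finset.sum_eq_single 0]
  · rw [pow_zero, pow_zero, map_one]
    simp
  · intro m hm hm0
    have hmN : m < N := Finset.mem_range.1 hm
    have hζN : ((ω⁻¹) ^ m) ^ N = 1 := by
      rw [← pow_mul, mul_comm, pow_mul, inv_pow, hω.pow_eq_one, inv_one, one_pow]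
    have hζ1 : (ω⁻¹) ^ m ≠ 1 := hω.inv.pow_ne_one_of_pos_of_lt hm0 hmN
    rw [geom_sum_eq hζ1, hζN, sub_self, zero_div, zero_smul]
  · intro h
    exact absurd (Finset.mem_range.2 hNpos) h

/-- FAITHFULNESS ⇒ the non-empty isotypic labels GENERATE `ℤ_N`: no `0 < m < N` kills them all. -/
theorem exists_iso_nondegenerate (ρH : LatticeRep H) {k₀ : H} {N : ℕ} (hN : orderOf k₀ = N)
    (hNpos : 0 < N) {ω : ℂ} (hω : IsPrimitiveRoot ω N) (m : ℕ) (hm0 : 0 < m) (hmN : m < N) :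
    ∃ j ∈ range N, (isoProj ρH k₀ ω N j).trace ≠ 0 ∧ ¬ N ∣ j * m := by
  classical
  have hω0 : ω ≠ 0 := hω.ne_zero hNpos.ne'
  have hωN : ω ^ N = 1 := hω.pow_eq_one
  by_contra hcon
  push Not at hcon
  -- every amplitude is fixed by `ρH(k₀^m)`
  have hfix : ∀ j ∈ range N, ρH.ρ (k₀ ^ m) * isoAmp ρH k₀ ω N j = isoAmp ρH k₀ ω N j := by
    intro j hj
    by_cases htr : (isoProj ρH k₀ ω N j).trace = 0
    · have hA : isoAmp ρH k₀ ω N j = 0 := by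
        have hP : isoProj ρH k₀ ω N j = 0 :=
          (posSemidef_isoProj ρH k₀ ω N j).trace_eq_zero_iff.1 htr
        exact Matrix.conjTranspose_mul_self_eq_zero.1 hP
      rw [hA, Matrix.mul_zero]
    · have hdvd : N ∣ j * m := hcon j hj htr
      rw [rho_pow_mul_isoAmp ρH hN hωN hω0, ← pow_mul, (hω.pow_eq_one_iff_dvd _).2 hdvd, one_smul]
  have hsum := sum_isoAmp ρH k₀ hNpos hω
  have h1 : ρH.ρ (k₀ ^ m) * ((N : ℂ) • (1 : Matrix (Fin ρH.N) (Fin ρH.N) ℂ)) =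
      (N : ℂ) • (1 : Matrix (Fin ρH.N) (Fin ρH.N) ℂ) := by
    conv_rhs => rw [← hsum, ← Finset.sum_congr rfl hfix]
    rw [← hsum, Finset.mul_sum]
  rw [Matrix.mul_smul, Matrix.mul_one] at h1
  have hone : ρH.ρ (k₀ ^ m) = 1 :=
    smul_right_injective (Matrix (Fin ρH.N) (Fin ρH.N) ℂ) (Nat.cast_ne_zero.2 hNpos.ne') h1
  have hk : k₀ ^ m = 1 := ρH.injective (by rw [hone, map_one])
  exact pow_ne_one_of_lt_orderOf hm0.ne' (hN ▸ hmN) hk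

/-- The exponent choice: labels `J ⊆ {0,…,N-1}` not all killed by any `0 < m < N` admit `f` with
`Σ_{j∈J} j·f(j) ≡ 1 (mod N)` (the subgroup of `ℤ_N` they generate is everything, by counting). -/
theorem exists_exponents {N : ℕ} (hNpos : 0 < N) (J : Finset ℕ) (hJ : ∀ j ∈ J, j < N)
    (hgen : ∀ m : ℕ, 0 < m → m < N → ∃ j ∈ J, ¬ N ∣ j * m) :
    ∃ f : ℕ → ℕ, (∑ j ∈ J, j * f j) ≡ 1 [MOD N] := by
  classical
  haveI : NeZero N := ⟨hNpos.ne'⟩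
  set S : Finset (ZMod N) := J.image (fun j : ℕ => (j : ZMod N)) with hS
  set B : AddSubgroup (ZMod N) := AddSubgroup.closure (S : Set (ZMod N)) with hBdef
  have hmemB : ∀ j ∈ J, ((j : ℕ) : ZMod N) ∈ B := fun j hj =>
    AddSubgroup.subset_closure (Finset.mem_coe.2 (Finset.mem_image_of_mem _ hj))
  have hB : B = ⊤ := by
    by_contra hne
    have hle : Nat.card B ≤ N := by
      have := AddSubgroup.card_le_card_addGroup B
      rwa [Nat.card_zmod] at this
    have hneq : Nat.card B ≠ N := by
      intro h
      apply hne
      rw [← AddSubgroup.card_eq_iff_eq_top, h, Nat.card_zmod]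
    have hlt : Nat.card B < N := lt_of_le_of_ne hle hneq
    have hpos : 0 < Nat.card B := Nat.card_pos
    obtain ⟨j, hj, hndvd⟩ := hgen (Nat.card B) hpos hlt
    apply hndvd
    have hx : Nat.card B • (⟨((j : ℕ) : ZMod N), hmemB j hj⟩ : B) = 0 := card_nsmul_eq_zero'
    have hx' : (Nat.card B) • ((j : ℕ) : ZMod N) = 0 := by
      have h := Subtype.ext_iff.1 hx
      rwa [AddSubgroup.coe_nsmul, AddSubgroup.coe_zero] at h
    rw [nsmul_eq_mul, ← Nat.cast_mul, ZMod.natCast_eq_zero_iff] at hx'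
    rwa [mul_comm] at hx'
  have h1B : (1 : ZMod N) ∈ B := by rw [hB]; exact AddSubgroup.mem_top 1
  -- pass to the additive monoid closure (a finite group: `-s = (N-1)•s`)
  have h1M : (1 : ZMod N) ∈ AddSubmonoid.closure (S : Set (ZMod N)) := by
    have h' : (1 : ZMod N) ∈ B.toAddSubmonoid := h1B
    rw [hBdef, AddSubgroup.closure_toAddSubmonoid] at h'
    refine (AddSubmonoid.closure_le.2 ?_) h'
    rintro x (hx | hx)
    · exact AddSubmonoid.subset_closure hx
    · have hs : -x ∈ (S : Set (ZMod N)) := by simpa using hx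
      have hN1 : (N - 1 + 1 : ℕ) = N := Nat.sub_add_cancel hNpos
      have hx' : x = (N - 1) • (-x) := by
        have h0 : ((N - 1 + 1 : ℕ)) • (-x) = 0 := by
          rw [hN1, nsmul_eq_mul, ZMod.natCast_self, zero_mul]
        rw [succ_nsmul] at h0
        have := eq_neg_of_add_eq_zero_left h0
        rw [neg_neg] at this
        exact this.symm
      rw [hx']
      exact AddSubmonoid.nsmul_mem _ (AddSubmonoid.subset_closure hs) _
  obtain ⟨f, -, hf⟩ := AddSubmonoid.mem_closure_finset.1 h1M
  refine ⟨fun j => f (j : ZMod N), ?_⟩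
  have hinj : ∀ a ∈ J, ∀ a' ∈ J, ((a : ℕ) : ZMod N) = ((a' : ℕ) : ZMod N) → a = a' := by
    intro a ha a' ha' h
    have := congrArg ZMod.val h
    rwa [ZMod.val_natCast, ZMod.val_natCast, Nat.mod_eq_of_lt (hJ a ha), Nat.mod_eq_of_lt (hJ a' ha')]
      at this
  rw [hS, Finset.sum_image hinj] at hf
  have hcast : (((∑ j ∈ J, j * f (j : ZMod N)) : ℕ) : ZMod N) = ((1 : ℕ) : ZMod N) := by
    rw [Nat.cast_one, ← hf, Nat.cast_sum]
    refine Finset.sum_congr rfl fun j _ => ?_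
    rw [Nat.cast_mul, nsmul_eq_mul, mul_comm]
  exact (ZMod.natCast_eq_natCast_iff _ _ _).1 hcast

end Generation


/-! ## §6f  S2ᵛ at EVERY cover datum with cyclic central kernel, for EVERY faithful `ρH`

Assembly of §5c (abstract split window ⇒ `TwistSplitWeight` family) with §6a–§6e (a split window for
`Γ = ⟨k₀⟩` exists for every faithful unitary `ρH`: the Fejér window of the isotypic Schur monomial). -/

section CyclicGeneral

open MeasureTheory Filter Topology
open Literature.MathematicalPhysics.QuantumFieldTheory Literature.MathematicalPhysics.QuantumLattice
open Summit.QuantumFields.YangMills.Theorems.NonSimplyConnectedLatticeGap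

variable {G H : Type} [Group G] [TopologicalSpace G] [Group H] [TopologicalSpace H]

/-- The Fejér window of a twist character is a split window for `Γ = ⟨k₀⟩`. -/
theorem isSplitWindow_windowOf {k₀ : H} {ω : ℂ} {u : H → ℂ} (hu : IsTwistChar k₀ ω u)
    (Γ : Subgroup H) (hΓ : Γ = Subgroup.zpowers k₀) {N : ℕ} (hN : orderOf k₀ = N) (hNpos : 0 < N)
    (hω : IsPrimitiveRoot ω N) : IsSplitWindow Γ (windowOf u N) :=
  ⟨continuous_windowOf hu.continuous N, windowOf_nonneg hu.norm_le_one N, windowOf_le_one hu.norm_le_one N,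
    windowOf_inv hu.inv N, windowOf_conj hu.conj N, windowOf_posType hu.gram N, windowOf_one hu.one hNpos,
    windowOf_exact hu.twist Γ hΓ hN hNpos hω⟩

/-- **Split windows exist for every faithful `ρH` and every cyclic central `Γ = ⟨k₀⟩`.** -/
theorem exists_isSplitWindow_of_cyclic (ρH : LatticeRep H) {k₀ : H} (hc : k₀ ∈ Subgroup.center H)
    (Γ : Subgroup H) (hΓ : Γ = Subgroup.zpowers k₀) {N : ℕ} (hN : orderOf k₀ = N) (hNpos : 0 < N) :
    ∃ W : H → ℝ, IsSplitWindow Γ W := by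
  classical
  set ω : ℂ := Complex.exp (2 * Real.pi * Complex.I / N) with hωdef
  have hω : IsPrimitiveRoot ω N := Complex.isPrimitiveRoot_exp N hNpos.ne'
  set J : Finset ℕ := (range N).filter (fun j => (isoProj ρH k₀ ω N j).trace ≠ 0) with hJdef
  have hJ : ∀ j ∈ J, j < N := fun j hj => Finset.mem_range.1 (Finset.mem_filter.1 hj).1
  have hgen : ∀ m : ℕ, 0 < m → m < N → ∃ j ∈ J, ¬ N ∣ j * m := by
    intro m hm0 hmN
    obtain ⟨j, hj, htr, hndvd⟩ := exists_iso_nondegenerate ρH hN hNpos hω m hm0 hmN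
    exact ⟨j, Finset.mem_filter.2 ⟨hj, htr⟩, hndvd⟩
  obtain ⟨f, hf⟩ := exists_exponents hNpos J hJ hgen
  let b : ℕ → ℕ := fun j => if (isoProj ρH k₀ ω N j).trace ≠ 0 then f j else 0
  have hb : ∀ j ∈ range N, b j ≠ 0 → (isoProj ρH k₀ ω N j).trace ≠ 0 := by
    intro j _ hbj htr
    apply hbj
    simp [b, htr]
  have hsum : (∑ j ∈ range N, j * b j) ≡ 1 [MOD N] := by
    have hre : ∑ j ∈ range N, j * b j = ∑ j ∈ J, j * f j := by
      rw [hJdef, Finset.sum_filter]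
      refine Finset.sum_congr rfl fun j _ => ?_
      by_cases h : (isoProj ρH k₀ ω N j).trace ≠ 0
      · simp [b, h]
      · simp [b, h]
    rw [hre]
    exact hf
  exact ⟨windowOf (∏ j ∈ range N, isoChar ρH k₀ ω N j ^ b j) N,
    isSplitWindow_windowOf (isTwistChar_isoMonomial ρH hc hN hNpos hω b hb hsum) Γ hΓ hN hNpos hω⟩

/-- **S2ᵛ `SplitVanishing` at every cover datum whose (finite, central) kernel is cyclic `⟨k₀⟩`, for EVERY
faithful unitary `ρH` and every `r`** — no Lie, simplicity or scalar-on-kernel hypothesis. -/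
theorem splitVanishingAt_cyclic_general [IsTopologicalGroup H] [CompactSpace H] [MeasurableSpace H]
    [BorelSpace H] (π : H →* G) (hπ : Continuous π) (hfin : (π.ker : Set H).Finite) {k₀ : H}
    (hker : π.ker = Subgroup.zpowers k₀) (hc : k₀ ∈ Subgroup.center H) {N : ℕ} (hN : orderOf k₀ = N)
    (hNpos : 0 < N) (ρH : LatticeRep H) (r : LatticeRep G) :
    ∃ c : ℝ → ℝ, Tendsto (fun β => c β * β) atTop atTop ∧ ∃ β_s : ℝ, ∀ β : ℝ, β_s ≤ β →
      ∃ w : H → ℝ, TwistSplitWeight π ρH r (c β) β w := by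
  obtain ⟨W, hW⟩ := exists_isSplitWindow_of_cyclic ρH hc π.ker hker hN hNpos
  exact splitVanishingAt_of_window π hπ hfin hW ρH r

/-- The same with the kernel hypothesis in its invariant form: `ker π` finite, central and CYCLIC. -/
theorem splitVanishingAt_of_cyclic_ker [IsTopologicalGroup H] [CompactSpace H] [MeasurableSpace H]
    [BorelSpace H] (π : H →* G) (hπ : Continuous π) (hfin : (π.ker : Set H).Finite)
    (hcen : π.ker ≤ Subgroup.center H) (hcyc : IsCyclic π.ker) (ρH : LatticeRep H) (r : LatticeRep G) :
    ∃ c : ℝ → ℝ, Tendsto (fun β => c β * β) atTop atTop ∧ ∃ β_s : ℝ, ∀ β : ℝ, β_s ≤ β →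
      ∃ w : H → ℝ, TwistSplitWeight π ρH r (c β) β w := by
  haveI : Finite π.ker := hfin.to_subtype
  obtain ⟨g, hg⟩ := IsCyclic.exists_generator (α := π.ker)
  have hker : π.ker = Subgroup.zpowers (g : H) := by
    apply le_antisymm
    · intro x hx
      obtain ⟨n, hn⟩ := Subgroup.mem_zpowers_iff.1 (hg ⟨x, hx⟩)
      exact Subgroup.mem_zpowers_iff.2 ⟨n, by simpa using congrArg Subtype.val hn⟩
    · exact Subgroup.zpowers_le.2 g.2
  have hN : orderOf (g : H) = Nat.card π.ker := by
    rw [Subgroup.orderOf_coe, orderOf_eq_card_of_forall_mem_zpowers hg]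
  exact splitVanishingAt_cyclic_general π hπ hfin hker (hcen g.2) hN Nat.card_pos ρH r

end CyclicGeneral

end Summit.QuantumFields.YangMills.Cruxes.IRcof.EquipartitionSeam.SchurFejer

end
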